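import Summits.ValiantsHypothesis.ValiantsHypothesis.Theorems.BarrierLeverPartitionMinorsHitByVPExactCoverDoor

/-!
# Route BarrierLever — item `PartitionMinorsHitByVP` (stmt-ValiantsHypothesis-19717):
# the ANCHORED DOOR 𝔄₂ (exp-door with private unit twists per anchor)

Link file (`--supports stmt-ValiantsHypothesis-19717`; cell valiant-natproofs, rung V4, 𝒟-side door (c);
prover seat val-np-p1 gen 14). Closes NO item; it reduces item 19717 BY NAME to the generic nonsingularity of one explicit
witness family on every (simplicial-complex) layout — the family of the seat's «anchored-peeling» line
(HOME/val-np-p1/g14/ANCHORED-MEMO-valnp1-g14.md §2; line proposal HOME/val-np-p1/g14/LINE-PROPOSAL-anchored-peeling.md).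

**The witness.** An ANCHOR is a pair `(A | B)` of an `x`-face and a `y`-face with `(|A|,|B|) ∈ {(1,1),(1,2),(2,1)}`; its
factor is
```
  T(A,B) = 1 + θ_{A,B} · x^A · y^B · ∏_b (1 + φ_{A,B,b} x_b) · ∏_d (1 + ψ_{A,B,d} y_d)
```
(private unit twists in BOTH variable groups), and `anchoredDoor θ φ ψ = ∏_{anchors} T(A,B)` (three double products; `≤ 2h³`
factors, size `≤ 47 h⁴`, `complexity_anchoredDoor_le`). In the zeon algebra it is `exp` of
`Σ_{(A|B)} Σ_{Z ⊇ A, W ⊇ B} θ φ^{Z∖A} ψ^{W∖B} x^Z y^W`: EVERY brick `(Z|W)` is present implicitly (so the exact-cover no-go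
`ExactCoverNoGo.not_exactCoverHypothesis` does not apply), with product weights anchored at small faces. It specialises to the
sequential door (p554023), to the bi-additive door (p544685) up to units, and to every brick product whose bricks have a part of
size `≤ 2` — in particular to the cube-versus-ball witness of `…CubeBall` (p568617).

**Results.** `complexity_anchorTerm_le`, `complexity_anchoredDoor_le` (sizes); `partitionMinor_hit_of_anchored` / `…_mem`
(THE DOOR: nonsingular layout matrix for some parameters ⇒ the layout is hit inside `SmallCircuits ℂ (h+h) 8`, `h ≥ 2`);
`partitionMinorsHitByVP_of_anchored` (`b = 8`, `h₀ = 2`) and `partitionMinorsHitByVP_of_anchored_lowerSets` (`b = 12`).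
The seat memo proves two peeling lemmas for this door (star step §3/§6.1, split step §6.2 — kernel template `…SplitStep`,
p571916) and records the census of the conjecture «every lower pair is peelable» (§6).

WHAT THIS IS NOT: the hypothesis «some parameters make the layout matrix nonsingular, on every injective (lower-set) layout» is
an OPEN conjecture; nothing is claimed about it, about crux stmt-ValiantsHypothesis-14610, or about `VP` versus `VNP`.
-/

set_option linter.dupNamespace false

namespace Summit.ValiantsHypothesis.ValiantsHypothesis.Theorems.BarrierLever.AnchoredDoor

open Finset MvPolynomial
open Literature.Barriers.ValiantsHypothesis Literature.Computability.AlgebraicComplexity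
open Summit.ValiantsHypothesis.ValiantsHypothesis.Theorems.BarrierLever.AdditiveDoor
  (truncation_spec degree_partitionExpo_le)
open Summit.ValiantsHypothesis.ValiantsHypothesis.Theorems.BarrierLever.ExactCoverDoor (complexity_monomial_le)

noncomputable section

variable {h : ℕ}

/-! ## 1. The witness -/

/-- One anchor factor `T(A,B) = 1 + θ x^A y^B ∏_b (1 + φ_b x_b) ∏_d (1 + ψ_d y_d)`. -/
def anchorTerm (θ : Finset (Fin h) → Finset (Fin h) → ℂ) (φ ψ : Finset (Fin h) → Finset (Fin h) → Fin h → ℂ)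
    (A B : Finset (Fin h)) : MvPolynomial (Fin (h + h)) ℂ :=
  1 + C (θ A B) * (∏ a ∈ A, X (Fin.castAdd h a)) * (∏ c ∈ B, X (Fin.natAdd h c)) *
    (∏ b : Fin h, (1 + C (φ A B b) * X (Fin.castAdd h b))) * (∏ d : Fin h, (1 + C (ψ A B d) * X (Fin.natAdd h d)))

/-- **The anchored door 𝔄₂**: the product of the anchor factors over all anchors `(vertex | vertex)`,
`(vertex | y-pair)`, `(x-pair | vertex)`. -/
def anchoredDoor (θ : Finset (Fin h) → Finset (Fin h) → ℂ) (φ ψ : Finset (Fin h) → Finset (Fin h) → Fin h → ℂ) :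
    MvPolynomial (Fin (h + h)) ℂ :=
  (∏ a : Fin h, ∏ c : Fin h, anchorTerm θ φ ψ {a} {c}) *
  (∏ a : Fin h, ∏ B ∈ Finset.powersetCard 2 (Finset.univ : Finset (Fin h)), anchorTerm θ φ ψ {a} B) *
  (∏ A ∈ Finset.powersetCard 2 (Finset.univ : Finset (Fin h)), ∏ c : Fin h, anchorTerm θ φ ψ A {c})

/-! ## 2. Sizes -/

/-- A twist product `∏_b (1 + C φ_b · X (e b))` has size `≤ 3h`. -/
theorem complexity_twist_le (φ : Fin h → ℂ) (e : Fin h → Fin (h + h)) :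
    complexity (∏ b : Fin h, (1 + C (φ b) * X (e b)) : MvPolynomial (Fin (h + h)) ℂ) ≤ 3 * h := by
  calc _ ≤ ∑ b : Fin h, complexity (1 + C (φ b) * X (e b) : MvPolynomial (Fin (h + h)) ℂ) +
        (Finset.univ : Finset (Fin h)).card := complexity_finset_prod_le _ _
    _ ≤ ∑ _b : Fin h, 2 + (Finset.univ : Finset (Fin h)).card := by
        gcongr with b _
        calc _ ≤ complexity (1 : MvPolynomial (Fin (h + h)) ℂ) +
              complexity (C (φ b) * X (e b) : MvPolynomial (Fin (h + h)) ℂ) + 1 := complexity_add_le_holds _ _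
          _ ≤ 0 + (complexity (C (φ b) : MvPolynomial (Fin (h + h)) ℂ) +
              complexity (X (e b) : MvPolynomial (Fin (h + h)) ℂ) + 1) + 1 := by
              gcongr
              · rw [← C_1, complexity_C_holds]
              · exact complexity_mul_le_holds _ _
          _ = 2 := by rw [complexity_C_holds, complexity_X_holds]
    _ = 3 * h := by simp; ring

/-- One anchor factor has size `≤ 8h + 5`. -/
theorem complexity_anchorTerm_le (θ : Finset (Fin h) → Finset (Fin h) → ℂ)
    (φ ψ : Finset (Fin h) → Finset (Fin h) → Fin h → ℂ) (A B : Finset (Fin h)) :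
    complexity (anchorTerm θ φ ψ A B) ≤ 8 * h + 5 := by
  rw [anchorTerm]
  calc _ ≤ complexity (1 : MvPolynomial (Fin (h + h)) ℂ) +
        complexity (C (θ A B) * (∏ a ∈ A, X (Fin.castAdd h a)) * (∏ c ∈ B, X (Fin.natAdd h c)) *
          (∏ b : Fin h, (1 + C (φ A B b) * X (Fin.castAdd h b))) *
          (∏ d : Fin h, (1 + C (ψ A B d) * X (Fin.natAdd h d))) : MvPolynomial (Fin (h + h)) ℂ) + 1 :=
        complexity_add_le_holds _ _
    _ ≤ 0 + ((((complexity (C (θ A B) : MvPolynomial (Fin (h + h)) ℂ) +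
          complexity (∏ a ∈ A, X (Fin.castAdd h a) : MvPolynomial (Fin (h + h)) ℂ) + 1) +
          complexity (∏ c ∈ B, X (Fin.natAdd h c) : MvPolynomial (Fin (h + h)) ℂ) + 1) +
          complexity (∏ b : Fin h, (1 + C (φ A B b) * X (Fin.castAdd h b)) : MvPolynomial (Fin (h + h)) ℂ) + 1) +
          complexity (∏ d : Fin h, (1 + C (ψ A B d) * X (Fin.natAdd h d)) : MvPolynomial (Fin (h + h)) ℂ) + 1) + 1 := by
        gcongr
        · rw [← C_1, complexity_C_holds]
        · refine (complexity_mul_le_holds _ _).trans ?_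
          gcongr
          refine (complexity_mul_le_holds _ _).trans ?_
          gcongr
          refine (complexity_mul_le_holds _ _).trans ?_
          gcongr
          exact complexity_mul_le_holds _ _
    _ ≤ 0 + ((((0 + h + 1) + h + 1) + 3 * h + 1) + 3 * h + 1) + 1 := by
        gcongr
        · exact (complexity_C_holds _).le
        · exact complexity_monomial_le _ _
        · exact complexity_monomial_le _ _
        · exact complexity_twist_le _ _
        · exact complexity_twist_le _ _
    _ = 8 * h + 5 := by ring

/-- Number of unordered pairs: `C(h,2) ≤ h²`. -/
theorem card_powersetCard_two_le : (Finset.powersetCard 2 (Finset.univ : Finset (Fin h))).card ≤ h * h := by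
  rw [Finset.card_powersetCard, Finset.card_univ, Fintype.card_fin]
  exact (Nat.choose_le_pow h 2).trans_eq (by ring)

/-- **Size of the anchored door**: `≤ 47 h⁴` (for `h ≥ 1`; crude). -/
theorem complexity_anchoredDoor_le (hh : 1 ≤ h) (θ : Finset (Fin h) → Finset (Fin h) → ℂ)
    (φ ψ : Finset (Fin h) → Finset (Fin h) → Fin h → ℂ) :
    complexity (anchoredDoor θ φ ψ) ≤ 47 * h ^ 4 := by
  have hP := card_powersetCard_two_le (h := h)
  have h1 : complexity (∏ a : Fin h, ∏ c : Fin h, anchorTerm θ φ ψ {a} {c}) ≤ h * (h * (8 * h + 5) + h) + h := by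
    calc _ ≤ ∑ a : Fin h, complexity (∏ c : Fin h, anchorTerm θ φ ψ {a} {c}) + (Finset.univ : Finset (Fin h)).card :=
          complexity_finset_prod_le _ _
      _ ≤ ∑ _a : Fin h, (h * (8 * h + 5) + h) + (Finset.univ : Finset (Fin h)).card := by
          gcongr with a _
          calc _ ≤ ∑ c : Fin h, complexity (anchorTerm θ φ ψ {a} {c}) + (Finset.univ : Finset (Fin h)).card :=
                complexity_finset_prod_le _ _
            _ ≤ ∑ _c : Fin h, (8 * h + 5) + (Finset.univ : Finset (Fin h)).card := by
                gcongr with c _; exact complexity_anchorTerm_le _ _ _ _ _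
            _ = h * (8 * h + 5) + h := by simp
      _ = h * (h * (8 * h + 5) + h) + h := by simp
  have h2 : complexity (∏ a : Fin h, ∏ B ∈ Finset.powersetCard 2 (Finset.univ : Finset (Fin h)),
      anchorTerm θ φ ψ {a} B) ≤ h * (h * h * (8 * h + 5) + h * h) + h := by
    calc _ ≤ ∑ a : Fin h, complexity (∏ B ∈ Finset.powersetCard 2 (Finset.univ : Finset (Fin h)),
          anchorTerm θ φ ψ {a} B) + (Finset.univ : Finset (Fin h)).card := complexity_finset_prod_le _ _
      _ ≤ ∑ _a : Fin h, (h * h * (8 * h + 5) + h * h) + (Finset.univ : Finset (Fin h)).card := by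
          gcongr with a _
          calc _ ≤ ∑ B ∈ Finset.powersetCard 2 (Finset.univ : Finset (Fin h)), complexity (anchorTerm θ φ ψ {a} B) +
                (Finset.powersetCard 2 (Finset.univ : Finset (Fin h))).card := complexity_finset_prod_le _ _
            _ ≤ ∑ _B ∈ Finset.powersetCard 2 (Finset.univ : Finset (Fin h)), (8 * h + 5) +
                (Finset.powersetCard 2 (Finset.univ : Finset (Fin h))).card := by
                gcongr with B _; exact complexity_anchorTerm_le _ _ _ _ _
            _ ≤ h * h * (8 * h + 5) + h * h := by
                rw [Finset.sum_const, smul_eq_mul]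
                gcongr
      _ = h * (h * h * (8 * h + 5) + h * h) + h := by simp
  have h3 : complexity (∏ A ∈ Finset.powersetCard 2 (Finset.univ : Finset (Fin h)), ∏ c : Fin h,
      anchorTerm θ φ ψ A {c}) ≤ h * h * (h * (8 * h + 5) + h) + h * h := by
    calc _ ≤ ∑ A ∈ Finset.powersetCard 2 (Finset.univ : Finset (Fin h)),
          complexity (∏ c : Fin h, anchorTerm θ φ ψ A {c}) +
          (Finset.powersetCard 2 (Finset.univ : Finset (Fin h))).card := complexity_finset_prod_le _ _
      _ ≤ ∑ _A ∈ Finset.powersetCard 2 (Finset.univ : Finset (Fin h)), (h * (8 * h + 5) + h) +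
          (Finset.powersetCard 2 (Finset.univ : Finset (Fin h))).card := by
          gcongr with A _
          calc _ ≤ ∑ c : Fin h, complexity (anchorTerm θ φ ψ A {c}) + (Finset.univ : Finset (Fin h)).card :=
                complexity_finset_prod_le _ _
            _ ≤ ∑ _c : Fin h, (8 * h + 5) + (Finset.univ : Finset (Fin h)).card := by
                gcongr with c _; exact complexity_anchorTerm_le _ _ _ _ _
            _ = h * (8 * h + 5) + h := by simp
      _ ≤ h * h * (h * (8 * h + 5) + h) + h * h := by
          rw [Finset.sum_const, smul_eq_mul]
          gcongr
  rw [anchoredDoor]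
  calc _ ≤ complexity ((∏ a : Fin h, ∏ c : Fin h, anchorTerm θ φ ψ {a} {c}) *
        (∏ a : Fin h, ∏ B ∈ Finset.powersetCard 2 (Finset.univ : Finset (Fin h)), anchorTerm θ φ ψ {a} B)) +
        complexity (∏ A ∈ Finset.powersetCard 2 (Finset.univ : Finset (Fin h)), ∏ c : Fin h,
          anchorTerm θ φ ψ A {c}) + 1 := complexity_mul_le_holds _ _
    _ ≤ ((h * (h * (8 * h + 5) + h) + h) + (h * (h * h * (8 * h + 5) + h * h) + h) + 1) +
        (h * h * (h * (8 * h + 5) + h) + h * h) + 1 := by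
        gcongr
        exact (complexity_mul_le_holds _ _).trans (by gcongr)
    _ ≤ 47 * h ^ 4 := by
        have : 1 ≤ h * h * h * h := by
          calc 1 = 1 * 1 * 1 * 1 := by ring
            _ ≤ h * h * h * h := by gcongr
        nlinarith [this, Nat.zero_le (h * h), Nat.zero_le (h * h * h)]

/-! ## 3. The door -/

/-- **THE ANCHORED DOOR (explicit size).** If some parameters make the layout matrix of the anchored door nonsingular, the
layout is hit at some `f` with `deg f ≤ 2h` and `L(f) ≤ (2h+2)² · 47h⁴ + 2h + 1`. -/
theorem partitionMinor_hit_of_anchored {ι : Type*} [Fintype ι] [DecidableEq ι] (h : ℕ) (hh : 1 ≤ h)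
    (u w : ι → Finset (Fin h)) (θ : Finset (Fin h) → Finset (Fin h) → ℂ)
    (φ ψ : Finset (Fin h) → Finset (Fin h) → Fin h → ℂ)
    (hdet : (Matrix.of fun i j : ι => MvPolynomial.coeff
      (∑ a ∈ u i, Finsupp.single (Fin.castAdd h a) 1 + ∑ c ∈ w j, Finsupp.single (Fin.natAdd h c) 1)
      (anchoredDoor θ φ ψ)).det ≠ 0) :
    ∃ f : MvPolynomial (Fin (h + h)) ℂ, f.totalDegree ≤ h + h ∧
      complexity f ≤ (h + h + 2) ^ 2 * (47 * h ^ 4) + (h + h + 1) ∧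
      (Matrix.of fun i j : ι => MvPolynomial.coeff
        (∑ a ∈ u i, Finsupp.single (Fin.castAdd h a) 1 +
          ∑ c ∈ w j, Finsupp.single (Fin.natAdd h c) 1) f).det ≠ 0 := by
  obtain ⟨hdeg, hcoeff, hsize⟩ := truncation_spec (anchoredDoor θ φ ψ) (h + h)
  refine ⟨∑ e ∈ Finset.range (h + h + 1), homogeneousComponent e (anchoredDoor θ φ ψ), hdeg, ?_, ?_⟩
  · exact hsize.trans (by gcongr; exact complexity_anchoredDoor_le hh θ φ ψ)
  · have hmat : (Matrix.of fun i j : ι => MvPolynomial.coeff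
        (∑ a ∈ u i, Finsupp.single (Fin.castAdd h a) 1 +
          ∑ c ∈ w j, Finsupp.single (Fin.natAdd h c) 1)
        (∑ e ∈ Finset.range (h + h + 1), homogeneousComponent e (anchoredDoor θ φ ψ))) =
        Matrix.of fun i j : ι => MvPolynomial.coeff
          (∑ a ∈ u i, Finsupp.single (Fin.castAdd h a) 1 +
            ∑ c ∈ w j, Finsupp.single (Fin.natAdd h c) 1) (anchoredDoor θ φ ψ) := by
      ext i j
      rw [Matrix.of_apply, Matrix.of_apply, hcoeff _ (degree_partitionExpo_le _ _)]
    rw [hmat]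
    exact hdet

/-- **THE ANCHORED DOOR (class form).** For `h ≥ 2` the truncated anchored door lies in `SmallCircuits ℂ (h+h) 8`. -/
theorem partitionMinor_hit_of_anchored_mem {ι : Type*} [Fintype ι] [DecidableEq ι] (h : ℕ) (hh : 2 ≤ h)
    (u w : ι → Finset (Fin h)) (θ : Finset (Fin h) → Finset (Fin h) → ℂ)
    (φ ψ : Finset (Fin h) → Finset (Fin h) → Fin h → ℂ)
    (hdet : (Matrix.of fun i j : ι => MvPolynomial.coeff
      (∑ a ∈ u i, Finsupp.single (Fin.castAdd h a) 1 + ∑ c ∈ w j, Finsupp.single (Fin.natAdd h c) 1)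
      (anchoredDoor θ φ ψ)).det ≠ 0) :
    ∃ f ∈ SmallCircuits ℂ (h + h) 8,
      (Matrix.of fun i j : ι => MvPolynomial.coeff
        (∑ a ∈ u i, Finsupp.single (Fin.castAdd h a) 1 +
          ∑ c ∈ w j, Finsupp.single (Fin.natAdd h c) 1) f).det ≠ 0 := by
  obtain ⟨f, hdeg, hsize, hf⟩ := partitionMinor_hit_of_anchored h (by omega) u w θ φ ψ hdet
  refine ⟨f, ⟨hdeg, hsize.trans ?_⟩, hf⟩
  -- (2h+2)² · 47 h⁴ + 2h + 1 ≤ (2h)^8 for h ≥ 2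
  have h4 : 4 ≤ h * h := by nlinarith
  calc (h + h + 2) ^ 2 * (47 * h ^ 4) + (h + h + 1)
      ≤ (3 * h) ^ 2 * (47 * h ^ 4) + 3 * h ^ 6 := by
        gcongr
        · omega
        · calc h + h + 1 ≤ 3 * h := by omega
            _ = 3 * h * 1 := by ring
            _ ≤ 3 * h * h ^ 5 := by gcongr; exact Nat.one_le_pow _ _ (by omega)
            _ = 3 * h ^ 6 := by ring
    _ = 426 * h ^ 6 * 1 := by ring
    _ ≤ 256 * h ^ 6 * (h * h) := by nlinarith [Nat.zero_le (h ^ 6)]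
    _ = (h + h) ^ 8 := by ring

/-- **The anchored door (arrow onto the route declaration).** If for every `h ≥ 2` and every injective layout SOME parameters
make the anchored door's layout matrix nonsingular, item 19717 `PartitionMinorsHitByVP` holds (`b = 8`, `h₀ = 2`). -/
theorem partitionMinorsHitByVP_of_anchored
    (hyp : ∀ h : ℕ, 2 ≤ h → ∀ (r : ℕ) (u w : Fin r → Finset (Fin h)),
      Function.Injective u → Function.Injective w →
      ∃ (θ : Finset (Fin h) → Finset (Fin h) → ℂ) (φ ψ : Finset (Fin h) → Finset (Fin h) → Fin h → ℂ),
        (Matrix.of fun i j : Fin r => MvPolynomial.coeff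
          (∑ a ∈ u i, Finsupp.single (Fin.castAdd h a) 1 +
            ∑ c ∈ w j, Finsupp.single (Fin.natAdd h c) 1) (anchoredDoor θ φ ψ)).det ≠ 0) :
    Summit.ValiantsHypothesis.ValiantsHypothesis.Theses.BarrierLever.PartitionMinorsHitByVP := by
  refine ⟨8, 2, fun h hh r u w hu hw => ?_⟩
  obtain ⟨θ, φ, ψ, hdet⟩ := hyp h hh r u w hu hw
  exact partitionMinor_hit_of_anchored_mem h hh u w θ φ ψ hdet

/-- **The anchored door on simplicial complexes.** By the lower-set reduction (`DownCompression.partitionMinorsHitByVP_of_lowerSets`)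
the hypothesis is needed on injective layouts with lower-set row and column families only (`b = 12`). -/
theorem partitionMinorsHitByVP_of_anchored_lowerSets
    (hyp : ∀ h : ℕ, 2 ≤ h → ∀ (r : ℕ) (u w : Fin r → Finset (Fin h)),
      Function.Injective u → Function.Injective w →
      IsLowerSet (Set.range u) → IsLowerSet (Set.range w) →
      ∃ (θ : Finset (Fin h) → Finset (Fin h) → ℂ) (φ ψ : Finset (Fin h) → Finset (Fin h) → Fin h → ℂ),
        (Matrix.of fun i j : Fin r => MvPolynomial.coeff
          (∑ a ∈ u i, Finsupp.single (Fin.castAdd h a) 1 +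
            ∑ c ∈ w j, Finsupp.single (Fin.natAdd h c) 1) (anchoredDoor θ φ ψ)).det ≠ 0) :
    Summit.ValiantsHypothesis.ValiantsHypothesis.Theses.BarrierLever.PartitionMinorsHitByVP := by
  refine DownCompression.partitionMinorsHitByVP_of_lowerSets ⟨8, 2, fun h hh r u w hu hw hlu hlw => ?_⟩
  obtain ⟨θ, φ, ψ, hdet⟩ := hyp h hh r u w hu hw hlu hlw
  exact partitionMinor_hit_of_anchored_mem h hh u w θ φ ψ hdet

end

end Summit.ValiantsHypothesis.ValiantsHypothesis.Theorems.BarrierLever.AnchoredDoor
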